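import Literature.Analysis.Prevalence.Union
import Literature.Probability.LatticeModels.ProductMeasureTools

/-!
# Countable unions of shy sets (HSY Fact 3″)

Hunt–Sauer–Yorke [HuntSauerYorke1992, §2 Fact 3″]: *the union of a countable collection of shy
sets is shy*; equivalently a countable intersection of prevalent sets is prevalent, so that shy
sets form a translation-invariant σ-ideal (with `IsShy.mono`, `isShy_empty`, `IsShy.vadd_set`).

We follow the printed proof:

1. `IsTransverse.exists_small` — **HSY Fact 2** (second half): a transverse measure can be
   replaced by a transverse *probability* measure carried by a compact set of diameter `≤ 2ε`
   (cover the compact set by finitely many `ε`-balls; one of them has positive measure; restrict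
   and normalise).
2. `exists_isProbabilityMeasure_forall_isTransverse` — the **infinite convolution**: given
   probability measures `νₙ` carried by compact sets `Kₙ ⊆ closedBall cₙ εₙ` with `∑ εₙ < ∞`,
   `νₙ` killing all translates of a Borel set `Bₙ`, the image `μ` of the product measure
   `⨂ νₙ` (Mathlib's `Measure.infinitePi`) under the summation map
   `x ↦ ∑' n, (xₙ - cₙ)` (continuous on the compact product `∏ Kₙ` by the Weierstrass M-test,
   Tychonoff) is a probability measure charging the compact image of `∏ Kₙ`, and it is transverse
   to every `Bₙ`: resampling the `n`-th coordinate (`⨂ νₖ = update_* ((⨂ νₖ) ⊗ νₙ)`,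
   `Literature.Probability.LatticeModels.map_update_infinitePi_prod`, i.e. `μ = νₙ ∗ (rest)`) and
   Fubini give `μ (v +ᵥ Bₙ) = ∫ νₙ {y | y + (tail sum) ∈ v +ᵥ Bₙ} = 0`.
3. `isShy_iUnion`, `Set.Countable.isShy_biUnion`, `Set.Countable.isShy_sUnion`,
   `isPrevalent_iInter` — **HSY Fact 3″** and its prevalent form.

## Hypotheses

Step 1 is stated for a pseudo-metric group topology. Steps 2–3 are stated for a *complete,
second-countable normed* abelian group `V` (`[NormedAddCommGroup V] [CompleteSpace V]
[SecondCountableTopology V] [BorelSpace V]`), e.g. a separable real Banach space. HSY state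
Fact 3″ for complete metric linear spaces (no separability; scaling is not needed, only a complete
translation-invariant metric). TODO(general form): completely metrizable abelian topological
groups (Christensen's Haar-null setting), and non-separable spaces.

## References

* B. R. Hunt, T. Sauer, J. A. Yorke, *Prevalence*, Bull. AMS 27 (1992) 217–238, §2 (Facts 2, 3″).
  [HuntSauerYorke1992]
-/

open MeasureTheory Set Filter Function Metric
open scoped Pointwise ENNReal Topology

namespace Literature.Analysis.Prevalence

/-! ### HSY Fact 2, second half: transverse probability measures with small support -/

section SmallSupport

variable {V : Type*} [AddCommGroup V] [MeasurableSpace V]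

/-- Normalised restriction: if all translates of `S` are `μ`-null and `K` is a compact set with
`0 < μ K < ∞`, then `(μ K)⁻¹ • μ|_K` is a transverse probability measure with `ν K = 1`.
[cite: HuntSauerYorke1992, §2 Fact 2] -/
theorem exists_isProbabilityMeasure_isTransverse [TopologicalSpace V] {μ : Measure V} {S K : Set V}
    (h : ∀ v : V, μ (v +ᵥ S) = 0) (hK : IsCompact K) (hpos : 0 < μ K) (hfin : μ K < ∞) :
    ∃ ν : Measure V, IsProbabilityMeasure ν ∧ IsTransverse ν S ∧ ν K = 1 := by
  have hK1 : ((μ K)⁻¹ • μ.restrict K) K = 1 := by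
    simp only [Measure.smul_apply, smul_eq_mul, Measure.restrict_apply_self]
    exact ENNReal.inv_mul_cancel hpos.ne' hfin.ne
  refine ⟨(μ K)⁻¹ • μ.restrict K, ⟨?_⟩, ?_, hK1⟩
  · simp only [Measure.smul_apply, smul_eq_mul, Measure.restrict_apply_univ]
    exact ENNReal.inv_mul_cancel hpos.ne' hfin.ne
  · exact (IsTransverse.restrict h hK hpos hfin).smul_measure (ENNReal.inv_ne_zero.2 hfin.ne)
      (ENNReal.inv_ne_top.2 hpos.ne')

variable [PseudoMetricSpace V]

/-- **HSY Fact 2** (second half): a transverse measure may be replaced by a transverse probability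
measure carried by a compact set of arbitrarily small diameter (contained in a closed `ε`-ball).
Proof as printed: cover the compact set of positive measure by finitely many `ε`-balls, one of them
meets it in positive measure; restrict to (the closure of) that piece and normalise.
[cite: HuntSauerYorke1992, §2 Fact 2] -/
theorem IsTransverse.exists_small {μ : Measure V} {S : Set V} (h : IsTransverse μ S) {ε : ℝ}
    (hε : 0 < ε) :
    ∃ ν : Measure V, IsProbabilityMeasure ν ∧ IsTransverse ν S ∧
      ∃ K : Set V, IsCompact K ∧ ν K = 1 ∧ ∃ c : V, K ⊆ closedBall c ε := by
  obtain ⟨K₀, hK₀, hpos, hfin⟩ := h.1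
  obtain ⟨t, -, htfin, hcover⟩ := hK₀.elim_finite_subcover_image (b := K₀)
    (c := fun k => ball k ε) (fun k _ => isOpen_ball)
    (fun k hk => mem_iUnion₂.2 ⟨k, hk, mem_ball_self hε⟩)
  have hex : ∃ k ∈ t, 0 < μ (K₀ ∩ closedBall k ε) := by
    by_contra hcon
    push Not at hcon
    refine hpos.ne' (measure_mono_null (fun x hx => ?_)
      ((measure_biUnion_null_iff htfin.countable).2 fun k hk => nonpos_iff_eq_zero.1 (hcon k hk)))
    obtain ⟨k, hk, hxk⟩ := mem_iUnion₂.1 (hcover hx)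
    exact mem_iUnion₂.2 ⟨k, hk, hx, ball_subset_closedBall hxk⟩
  obtain ⟨k, -, hk⟩ := hex
  have hK : IsCompact (K₀ ∩ closedBall k ε) := hK₀.inter_right isClosed_closedBall
  have hKfin : μ (K₀ ∩ closedBall k ε) < ∞ := (measure_mono inter_subset_left).trans_lt hfin
  obtain ⟨ν, hνp, hν, hνK⟩ := exists_isProbabilityMeasure_isTransverse h.2 hK hk hKfin
  exact ⟨ν, hνp, hν, _, hK, hνK, k, inter_subset_right⟩

end SmallSupport

/-! ### The infinite convolution (proof of HSY Fact 3″) -/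

section InfiniteConvolution

variable {V : Type*} [NormedAddCommGroup V] [CompleteSpace V] [SecondCountableTopology V]
  [MeasurableSpace V] [BorelSpace V]

/-- **Infinite convolution of transverse measures** (the construction in the proof of HSY
Fact 3″). Let `Bₙ` be Borel sets and `νₙ` probability measures with `νₙ (v +ᵥ Bₙ) = 0` for all
`v`, each carried by a compact set `Kₙ ⊆ closedBall cₙ εₙ` with `∑ εₙ < ∞`. Then there is ONE
probability measure transverse to every `Bₙ`: the image of `⨂ νₙ` under
`x ↦ ∑' n, (xₙ - cₙ)`. [cite: HuntSauerYorke1992, §2 Fact 3″] -/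
theorem exists_isProbabilityMeasure_forall_isTransverse (B : ℕ → Set V)
    (hB : ∀ n, MeasurableSet (B n)) (ν : ℕ → Measure V) [∀ n, IsProbabilityMeasure (ν n)]
    (hνB : ∀ n (v : V), ν n (v +ᵥ B n) = 0) (K : ℕ → Set V) (hK : ∀ n, IsCompact (K n))
    (hνK : ∀ n, ν n (K n) = 1) (c : ℕ → V) {ε : ℕ → ℝ} (hε : Summable ε)
    (hKc : ∀ n, K n ⊆ closedBall (c n) (ε n)) :
    ∃ μ : Measure V, IsProbabilityMeasure μ ∧ ∀ n, IsTransverse μ (B n) := by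
  classical
  -- the compact product `G = ∏ Kₙ` and the summation map `Ψ`, continuous on `G`
  have hG : MeasurableSet (Set.pi univ K) :=
    MeasurableSet.univ_pi fun n => (hK n).isClosed.measurableSet
  have hbound : ∀ n (x : ℕ → V), x ∈ Set.pi univ K → ‖x n - c n‖ ≤ ε n := fun n x hx => by
    have := hKc n (hx n (mem_univ n))
    rwa [mem_closedBall, dist_eq_norm] at this
  have hΨ : ContinuousOn (fun x : ℕ → V => ∑' n, (x n - c n)) (Set.pi univ K) :=
    continuousOn_tsum (fun n => ((continuous_apply n).sub continuous_const).continuousOn) hε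
      hbound
  -- the (globally measurable) summation map `Φ`, equal to `Ψ` on `G` and `0` off `G`
  set Φ : (ℕ → V) → V := (Set.pi univ K).piecewise (fun x => ∑' n, (x n - c n)) 0 with hΦ
  have hΦm : Measurable Φ := hΨ.measurable_piecewise continuousOn_const hG
  have hΦG : IsCompact (Φ '' Set.pi univ K) := by
    rw [hΦ, (piecewise_eqOn (Set.pi univ K) _ _).image_eq]
    exact (isCompact_univ_pi hK).image_of_continuousOn hΨ
  -- `⨂ νₙ`-almost every point lies in `G`
  have hPG : ∀ᵐ x ∂Measure.infinitePi ν, x ∈ Set.pi univ K := by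
    simp only [mem_univ_pi]
    rw [ae_all_iff]
    intro n
    have hn : ∀ᵐ y ∂ν n, y ∈ K n := by
      rw [ae_iff]
      exact (prob_compl_eq_zero_iff (hK n).isClosed.measurableSet).2 (hνK n)
    exact (measurePreserving_eval_infinitePi ν n).quasiMeasurePreserving.ae hn
  have hPG1 : Measure.infinitePi ν (Set.pi univ K) = 1 := by
    rw [← prob_compl_eq_zero_iff hG]
    exact ae_iff.1 hPG
  -- value of `Φ` after resampling one coordinate inside `G`
  have hΦupd : ∀ x ∈ Set.pi univ K, ∀ n, ∀ y ∈ K n,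
      Φ (update x n y) = y - c n - (x n - c n) + Φ x := by
    intro x hx n y hy
    have hxy : update x n y ∈ Set.pi univ K := fun m _ => by
      rcases eq_or_ne m n with rfl | hmn
      · simpa using hy
      · simpa [hmn] using hx m (mem_univ m)
    rw [hΦ, piecewise_eq_of_mem _ _ _ hxy, piecewise_eq_of_mem _ _ _ hx]
    have hsum : Summable fun m => x m - c m :=
      Summable.of_norm_bounded hε fun m => hbound m x hx
    have hfun : (fun m => update x n y m - c m) = update (fun m => x m - c m) n (y - c n) := by
      funext m
      exact apply_update (fun m z => z - c m) x n y m
    rw [hfun]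
    exact (hsum.hasSum.update n (y - c n)).tsum_eq
  refine ⟨(Measure.infinitePi ν).map Φ, Measure.isProbabilityMeasure_map hΦm.aemeasurable,
    fun n => ?_⟩
  refine ⟨⟨Φ '' Set.pi univ K, hΦG, ?_, measure_lt_top _ _⟩, fun v => ?_⟩
  · -- the image of `G` has full measure
    rw [Measure.map_apply hΦm hΦG.measurableSet]
    refine lt_of_lt_of_le ?_ (measure_mono (subset_preimage_image Φ _))
    rw [hPG1]
    exact one_pos
  · -- transversality: resample the `n`-th coordinate and use Fubini
    have hA : MeasurableSet (v +ᵥ B n) := (hB n).const_vadd v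
    rw [Measure.map_apply hΦm hA,
      ← Literature.Probability.LatticeModels.map_update_infinitePi_prod ν n,
      Measure.map_apply measurable_update' (hΦm hA),
      Measure.prod_apply (measurable_update' (hΦm hA))]
    refine (lintegral_congr_ae (hPG.mono fun x hx => ?_)).trans lintegral_zero
    -- for `x ∈ G`, the section `{y | Φ (update x n y) ∈ v +ᵥ Bₙ}` lies in `Kₙᶜ ∪ (translate of Bₙ)`
    change ν n (Prod.mk x ⁻¹' ((fun p : (ℕ → V) × V => update p.1 n p.2) ⁻¹' (Φ ⁻¹' (v +ᵥ B n))))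
      = 0
    set d : V := - c n - (x n - c n) + Φ x with hd
    refine measure_mono_null (t := (K n)ᶜ ∪ ((-d + v) +ᵥ B n)) (fun y hy => ?_)
      (measure_union_null ((prob_compl_eq_zero_iff (hK n).isClosed.measurableSet).2 (hνK n))
        (hνB n (-d + v)))
    by_cases hyK : y ∈ K n
    · right
      have hy' : Φ (update x n y) ∈ v +ᵥ B n := hy
      rw [hΦupd x hx n y hyK] at hy'
      rw [← vadd_vadd, mem_vadd_set_iff_neg_vadd_mem, neg_neg, vadd_eq_add]
      convert hy' using 1
      rw [hd]
      abel
    · exact Or.inl hyK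

end InfiniteConvolution

/-! ### HSY Fact 3″ -/

section CountableUnion

variable {V : Type*} [NormedAddCommGroup V] [CompleteSpace V] [SecondCountableTopology V]
  [MeasurableSpace V] [BorelSpace V]

/-- **HSY Fact 3″** (sequences): a countable union of shy sets, indexed by `ℕ`, is shy.
[cite: HuntSauerYorke1992, §2 Fact 3″] -/
theorem isShy_iUnion_nat {S : ℕ → Set V} (h : ∀ n, IsShy (S n)) : IsShy (⋃ n, S n) := by
  choose B hSB hB μ hμ using h
  have hsmall := fun n => (hμ n).exists_small (ε := ((1 : ℝ) / 2) ^ n) (by positivity)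
  choose ν hνp hν K hK hνK c hKc using hsmall
  obtain ⟨ρ, -, hρ⟩ := exists_isProbabilityMeasure_forall_isTransverse B hB ν
    (fun n v => (hν n).2 v) K hK hνK c summable_geometric_two hKc
  exact ⟨⋃ n, B n, iUnion_mono hSB, MeasurableSet.iUnion hB, ρ, IsTransverse.iUnion hρ⟩

/-- **HSY Fact 3″**: the union of a countable collection of shy sets is shy (in a separable Banach
space, or any complete second-countable normed abelian group). With `isShy_empty`, `IsShy.mono`
and `IsShy.vadd_set`: shy sets form a translation-invariant σ-ideal.
[cite: HuntSauerYorke1992, §2 Fact 3″] -/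
theorem isShy_iUnion {ι : Type*} [Countable ι] {S : ι → Set V} (h : ∀ i, IsShy (S i)) :
    IsShy (⋃ i, S i) := by
  cases isEmpty_or_nonempty ι
  · rw [iUnion_of_empty]
    exact isShy_empty
  · obtain ⟨f, hf⟩ := exists_surjective_nat ι
    rw [← hf.iUnion_comp S]
    exact isShy_iUnion_nat fun n => h (f n)

/-- **HSY Fact 3″** (indexed by a countable set). [cite: HuntSauerYorke1992, §2 Fact 3″] -/
theorem _root_.Set.Countable.isShy_biUnion {ι : Type*} {I : Set ι} (hI : I.Countable)
    {S : ι → Set V} (h : ∀ i ∈ I, IsShy (S i)) : IsShy (⋃ i ∈ I, S i) := by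
  have : Countable I := hI.to_subtype
  rw [biUnion_eq_iUnion]
  exact isShy_iUnion fun i => h i i.2

/-- **HSY Fact 3″** (countable families of sets). [cite: HuntSauerYorke1992, §2 Fact 3″] -/
theorem _root_.Set.Countable.isShy_sUnion {𝒮 : Set (Set V)} (h𝒮 : 𝒮.Countable)
    (h : ∀ S ∈ 𝒮, IsShy S) : IsShy (⋃₀ 𝒮) := by
  rw [sUnion_eq_biUnion]
  exact h𝒮.isShy_biUnion h

/-- **HSY Fact 3″** (prevalent form): a countable intersection of prevalent sets is prevalent —
"prevalent" behaves like "almost every". [cite: HuntSauerYorke1992, §2 Fact 3″] -/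
theorem isPrevalent_iInter {ι : Type*} [Countable ι] {S : ι → Set V}
    (h : ∀ i, IsPrevalent (S i)) : IsPrevalent (⋂ i, S i) := by
  rw [IsPrevalent, compl_iInter]
  exact isShy_iUnion h

end CountableUnion

end Literature.Analysis.Prevalence
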